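import Summits.BirchSwinnertonDyer.Rank1Residual.F1Sign2.DoorFieldAtTwo
import HarnessLib

/-!
# Route ByReductionTypeAtTwo, crux `RankOneAtTwoBigImageOddLocal` (stmt-BirchSwinnertonDyer-23715), line `one_door_analytic`,
# residue `R_S` (`#Ш(W)[2] = 4`): -desc §28 row E `ResidueDoorFieldShaDeepAtTwo` is a KERNEL corollary of rows B + C — no Cassels–Tate

Lead prover seat `bsd-line-fkl-p1` g18 (2026-08-29).  THEOREMS ONLY (standard axioms; no `def`, no named fact, no `sorry`, nothing
conditional beyond the two row hypotheses).  Helper `--supports stmt-BirchSwinnertonDyer-23715`; it closes nothing and BSD is not proved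
by any of this.

REF1-AUDIT §153 (on -desc g20's MEMO-desc §28, typed by -ty g14 as `Rank1Residual/F1Sign2/DoorFieldAtTwo.lean`, p683600) graded row E
(«bits disagree ⇒ `Ш(W/K_d)` has an element of order `8`») THEOREM-in-print = B + C + the Cassels–Tate square structure
`Ш(W/K)[2^∞] ≅ N ⊕ N`, and named the glue `E ⟸ B + C + N²` a PROVER TARGET («door: gk2 LEAD's
`exists_nondegenerate_alternating_pairing_primaryComponent_sha`»).  This file proves the glue WITHOUT any pairing:

* `residueDoorFieldShaDeepAtTwo_of_rows : ResidueDoorFieldShaTwoCardAtTwo → ResidueDoorFieldShaOrderAtTwo → ResidueDoorFieldShaDeepAtTwo`.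

Counting argument.  (i) `natCard_inf_torsionBy_four_le_sq`: for any subgroup `S ≤ A` of an abelian group, doubling maps `S[4]` to
`S[2]` with kernel `S[2]`, so `#S[4] ≤ #S[2]²`; (ii) `natCard_inf_torsionBy_four_eq_sq`: if moreover `S[2] ⊆ 2·S[4]` (the tree's
Cassels–Tate bit `ShaTwoInTwiceShaFour`, `θ = +1`) the doubling map is onto and `#S[4] = #S[2]²`; (iii)
`exists_order_eight_of_natCard_primaryComponent`: if NO element of `S` has order `8` then `S[2^∞] = S[4]` (induction on the exponent),
so `#S[2^∞] ≤ #S[2]²` and `S[2^∞]` is finite — contrapositively, `#S[2] = n` together with «`S[2^∞]` infinite or of order `> n²`»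
forces an element of order `8`.  On the residue at a rank-`0` door field with DISAGREEING bits: the curve `V ∈ {W, W^{(d_K)}}` with
`θ(V) = +1` has `#Ш(V)[2] = 4` (tree DESC-27-X `shaTwoCard_doorTwist_eq_four` for the twin), hence `#Ш(V)[4] = 16` and
`#Ш(V)[2^∞] ∈ {0} ∪ [16, ∞)` (`0` = infinite), the other curve has `#Ш[2^∞] ∈ {0} ∪ [4, ∞)`; row C multiplies:
`#Ш(W/K)[2^∞] ∈ {0} ∪ [64, ∞)`; row B gives `#Ш(W/K)[2] = 4`; and `64 > 4²`.  So depth `≥ 3` is created in the door field exactly as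
-desc's census saw it (`(ℤ/2^k)²`, `k ≥ 3`, at mixed doors), and the statement needs neither finiteness of `Ш` nor the alternating
pairing.

References: [cite: Kramer1981, Thm. 1, Prop. 7, Thm. 2]; [cite: Cassels1962ArithmeticIV, Thm. 1.1] (not used — that is the point).
-/

set_option autoImplicit false

noncomputable section

open scoped Classical

set_option linter.dupNamespace false

namespace Summit.BirchSwinnertonDyer.BirchSwinnertonDyer.Theorems.RankOneAtTwoOneDoor

open WeierstrassCurve Literature.NumberTheory.EllipticCurves
  Summit.BirchSwinnertonDyer.Rank1Residual.F1Sign2 AddSubgroup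

/-! ## §1 Counting in an abelian group: `S[4]` against `S[2]`, and elements of order `8` -/

section Algebra

variable {A : Type*} [AddCommGroup A] (S : AddSubgroup A)

/-- If no element of `S` has order `8` (every `c ∈ S` with `8c = 0` has `4c = 0`), then every element of `S` of `2`-power order is
killed by `4` (induction on the exponent: `2^{k+1} x = 0 ⇒ 4·(2x) = 0 ⇒ 8x = 0 ⇒ 4x = 0`). -/
theorem four_nsmul_eq_zero_of_two_pow_nsmul_eq_zero (h8 : ∀ c ∈ S, (8 : ℕ) • c = 0 → (4 : ℕ) • c = 0) :
    ∀ k : ℕ, ∀ x ∈ S, (2 : ℕ) ^ k • x = 0 → (4 : ℕ) • x = 0 := by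
  intro k
  induction k with
  | zero =>
    intro x _ hx
    rw [pow_zero, one_smul] at hx
    rw [hx, smul_zero]
  | succ k ih =>
    intro x hx h
    have h2 : (2 : ℕ) ^ k • ((2 : ℕ) • x) = 0 := by
      rw [smul_smul, ← pow_succ]; exact h
    have h4 : (4 : ℕ) • ((2 : ℕ) • x) = 0 := ih _ (S.nsmul_mem hx 2) h2
    refine h8 x hx ?_
    rw [show (8 : ℕ) = 4 * 2 from rfl, mul_smul]
    exact h4

/-- **`#S[4] ≤ #S[2]²` and `S[4]` is finite when `S[2]` is**: doubling maps `S ∩ A[4]` into `S ∩ A[2]` with kernel inside `S ∩ A[2]`. -/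
theorem natCard_inf_torsionBy_four_le_sq [Finite ↥(S ⊓ torsionBy A (2 : ℕ))] :
    Finite ↥(S ⊓ torsionBy A (4 : ℕ)) ∧
      Nat.card ↥(S ⊓ torsionBy A (4 : ℕ)) ≤ Nat.card ↥(S ⊓ torsionBy A (2 : ℕ)) * Nat.card ↥(S ⊓ torsionBy A (2 : ℕ)) := by
  -- the doubling homomorphism `S[4] → S[2]`
  let d : ↥(S ⊓ torsionBy A (4 : ℕ)) →+ ↥(S ⊓ torsionBy A (2 : ℕ)) :=
    AddMonoidHom.mk' (fun x => ⟨(2 : ℕ) • (x : A), mem_inf.mpr ⟨S.nsmul_mem (mem_inf.mp x.2).1 2,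
        torsionBy.nsmul_iff.mpr (by
          rw [smul_smul]; exact torsionBy.nsmul_iff.mp (mem_inf.mp x.2).2)⟩⟩)
      (fun x y => by ext; simp [smul_add])
  -- its kernel embeds in `S[2]`
  let e : ↥d.ker → ↥(S ⊓ torsionBy A (2 : ℕ)) := fun x =>
    ⟨((x : ↥(S ⊓ torsionBy A (4 : ℕ))) : A), mem_inf.mpr ⟨(mem_inf.mp x.1.2).1, torsionBy.nsmul_iff.mpr (by
      have hx := x.2
      rw [AddMonoidHom.mem_ker] at hx
      exact congrArg (fun z : ↥(S ⊓ torsionBy A (2 : ℕ)) => (z : A)) hx)⟩⟩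
  have he : Function.Injective e := by
    intro x y hxy
    apply Subtype.ext; apply Subtype.ext
    exact congrArg (fun z : ↥(S ⊓ torsionBy A (2 : ℕ)) => (z : A)) hxy
  haveI hker : Finite ↥d.ker := Finite.of_injective e he
  have hker_le : Nat.card ↥d.ker ≤ Nat.card ↥(S ⊓ torsionBy A (2 : ℕ)) := Nat.card_le_card_of_injective e he
  -- its range is a subgroup of the finite `S[2]`
  haveI hrange : Finite ↥d.range := inferInstance
  have hrange_le : Nat.card ↥d.range ≤ Nat.card ↥(S ⊓ torsionBy A (2 : ℕ)) :=
    Nat.card_le_card_of_injective _ Subtype.val_injective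
  -- `#S[4] = #(S[4]/ker) · #ker = #range · #ker`
  have hmul : Nat.card ↥(S ⊓ torsionBy A (4 : ℕ)) = Nat.card ↥d.range * Nat.card ↥d.ker := by
    rw [card_eq_card_quotient_mul_card_addSubgroup d.ker, Nat.card_congr (QuotientAddGroup.quotientKerEquivRange d).toEquiv]
  have hfin : Finite ↥(S ⊓ torsionBy A (4 : ℕ)) := by
    apply Nat.finite_of_card_ne_zero
    rw [hmul]
    exact mul_ne_zero (Nat.card_pos.ne') (Nat.card_pos.ne')
  exact ⟨hfin, hmul ▸ Nat.mul_le_mul hrange_le hker_le⟩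

/-- **`#S[4] = #S[2]²` when `S[2] ⊆ 2·S[4]`** (the Cassels–Tate bit `θ = +1` in the tree's form `ShaTwoInTwiceShaFour`): then doubling
`S ∩ A[4] → S ∩ A[2]` is onto with kernel `S ∩ A[2]`. -/
theorem natCard_inf_torsionBy_four_eq_sq
    (hdiv : ∀ c ∈ S, (2 : ℕ) • c = 0 → ∃ c' ∈ S, (4 : ℕ) • c' = 0 ∧ (2 : ℕ) • c' = c) :
    Nat.card ↥(S ⊓ torsionBy A (4 : ℕ)) = Nat.card ↥(S ⊓ torsionBy A (2 : ℕ)) * Nat.card ↥(S ⊓ torsionBy A (2 : ℕ)) := by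
  let d : ↥(S ⊓ torsionBy A (4 : ℕ)) →+ ↥(S ⊓ torsionBy A (2 : ℕ)) :=
    AddMonoidHom.mk' (fun x => ⟨(2 : ℕ) • (x : A), mem_inf.mpr ⟨S.nsmul_mem (mem_inf.mp x.2).1 2,
        torsionBy.nsmul_iff.mpr (by
          rw [smul_smul]; exact torsionBy.nsmul_iff.mp (mem_inf.mp x.2).2)⟩⟩)
      (fun x y => by ext; simp [smul_add])
  have hsurj : Function.Surjective d := by
    intro c
    obtain ⟨c', hc'S, h4, h2⟩ := hdiv (c : A) (mem_inf.mp c.2).1 (torsionBy.nsmul_iff.mp (mem_inf.mp c.2).2)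
    exact ⟨⟨c', mem_inf.mpr ⟨hc'S, torsionBy.nsmul_iff.mpr h4⟩⟩, Subtype.ext h2⟩
  -- kernel `≃ S[2]`
  have hker : Nat.card ↥d.ker = Nat.card ↥(S ⊓ torsionBy A (2 : ℕ)) := by
    refine Nat.card_congr
      { toFun := fun x => ⟨((x : ↥(S ⊓ torsionBy A (4 : ℕ))) : A), mem_inf.mpr ⟨(mem_inf.mp x.1.2).1,
          torsionBy.nsmul_iff.mpr (by
            have hx := x.2
            rw [AddMonoidHom.mem_ker] at hx
            exact congrArg (fun z : ↥(S ⊓ torsionBy A (2 : ℕ)) => (z : A)) hx)⟩⟩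
        invFun := fun y => ⟨⟨(y : A), mem_inf.mpr ⟨(mem_inf.mp y.2).1, torsionBy.nsmul_iff.mpr (by
            rw [show (4 : ℕ) = 2 * 2 from rfl, mul_smul, torsionBy.nsmul_iff.mp (mem_inf.mp y.2).2, smul_zero])⟩⟩, by
            rw [AddMonoidHom.mem_ker]
            exact Subtype.ext (torsionBy.nsmul_iff.mp (mem_inf.mp y.2).2)⟩
        left_inv := fun x => by ext; rfl
        right_inv := fun y => by ext; rfl }
  rw [card_eq_card_quotient_mul_card_addSubgroup d.ker,
    Nat.card_congr (QuotientAddGroup.quotientKerEquivOfSurjective d hsurj).toEquiv, hker]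

/-- `S ∩ A[4]` embeds in the `2`-primary component of `S`; so `#S[4] ≤ #S[2^∞]` whenever the latter is finite. -/
theorem natCard_inf_torsionBy_four_le_primaryComponent [Finite ↥(AddCommGroup.primaryComponent ↥S 2)] :
    Nat.card ↥(S ⊓ torsionBy A (4 : ℕ)) ≤ Nat.card ↥(AddCommGroup.primaryComponent ↥S 2) := by
  let f : ↥(S ⊓ torsionBy A (4 : ℕ)) → ↥(AddCommGroup.primaryComponent ↥S 2) := fun x =>
    ⟨⟨(x : A), (mem_inf.mp x.2).1⟩, ⟨2, Subtype.ext (by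
      simpa using torsionBy.nsmul_iff.mp (mem_inf.mp x.2).2)⟩⟩
  refine Nat.card_le_card_of_injective f (fun x y hxy => ?_)
  apply Subtype.ext
  have := congrArg (fun z : ↥(AddCommGroup.primaryComponent ↥S 2) => ((z : ↥S) : A)) hxy
  exact this

/-- **Elements of order `8` from counting.**  If `#S[2] = n ≠ 0` and the `2`-primary component of `S` is infinite (`Nat.card = 0`) or
of order `> n²`, then some `c ∈ S` has `8c = 0 ≠ 4c`: otherwise `S[2^∞] = S[4]` has order `≤ n²`. -/
theorem exists_order_eight_of_natCard_primaryComponent {n : ℕ} (hn : n ≠ 0)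
    (h2 : Nat.card ↥(S ⊓ torsionBy A (2 : ℕ)) = n)
    (hbig : Nat.card ↥(AddCommGroup.primaryComponent ↥S 2) = 0 ∨
      n * n < Nat.card ↥(AddCommGroup.primaryComponent ↥S 2)) :
    ∃ c ∈ S, (8 : ℕ) • c = 0 ∧ (4 : ℕ) • c ≠ 0 := by
  by_contra hno
  push Not at hno
  have h4 := four_nsmul_eq_zero_of_two_pow_nsmul_eq_zero S hno
  haveI : Finite ↥(S ⊓ torsionBy A (2 : ℕ)) := Nat.finite_of_card_ne_zero (h2 ▸ hn)
  obtain ⟨hfin4, hle⟩ := natCard_inf_torsionBy_four_le_sq S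
  haveI := hfin4
  -- the `2`-primary component embeds in `S[4]`
  let g : ↥(AddCommGroup.primaryComponent ↥S 2) → ↥(S ⊓ torsionBy A (4 : ℕ)) := fun x =>
    ⟨((x : ↥S) : A), mem_inf.mpr ⟨(x : ↥S).2, torsionBy.nsmul_iff.mpr (by
      obtain ⟨k, hk⟩ := (AddCommGroup.mem_primaryComponent).mp x.2
      have hk' : (2 : ℕ) ^ k • ((x : ↥S) : A) = 0 := by
        have := congrArg (fun z : ↥S => (z : A)) hk
        simpa using this
      exact h4 k _ (x : ↥S).2 hk')⟩⟩
  have hg : Function.Injective g := by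
    intro x y hxy
    apply Subtype.ext; apply Subtype.ext
    exact congrArg (fun z : ↥(S ⊓ torsionBy A (4 : ℕ)) => (z : A)) hxy
  haveI : Finite ↥(AddCommGroup.primaryComponent ↥S 2) := Finite.of_injective g hg
  have hcard := Nat.card_le_card_of_injective g hg
  rcases hbig with h0 | hlt
  · exact (Nat.card_pos (α := ↥(AddCommGroup.primaryComponent ↥S 2))).ne' h0
  · rw [h2] at hle
    omega

end Algebra

/-! ## §2 On one curve: `#Ш[2] = 4` bounds `#Ш[2^∞]` below; with `θ = +1` by `16` -/

/-- `#Ш(V)[2] = 4 ⇒ #Ш(V)[2^∞] ∈ {0} ∪ [4, ∞)` (`0` = infinite; tree embedding `twoTorsionToPrimary`). -/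
theorem shaTwoPrimaryCard_eq_zero_or_four_le (V : WeierstrassCurve ℚ) (h2 : shaTwoCard V = 4) :
    shaTwoPrimaryCard V = 0 ∨ 4 ≤ shaTwoPrimaryCard V := by
  by_cases h0 : shaTwoPrimaryCard V = 0
  · exact Or.inl h0
  · right
    haveI : Finite ↥(AddCommGroup.primaryComponent ↥V.sha 2) := Nat.finite_of_card_ne_zero h0
    rw [← h2]
    exact Nat.card_le_card_of_injective _ (twoTorsionToPrimary_injective V.sha)

/-- `#Ш(V)[2] = 4 ∧ θ(V) = +1 ⇒ #Ш(V)[2^∞] ∈ {0} ∪ [16, ∞)`: the Cassels–Tate bit makes doubling `Ш[4] → Ш[2]` onto, so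
`#Ш(V)[4] = 16`. -/
theorem shaTwoPrimaryCard_eq_zero_or_sixteen_le (V : WeierstrassCurve ℚ) (h2 : shaTwoCard V = 4)
    (hθ : ShaTwoInTwiceShaFour V) : shaTwoPrimaryCard V = 0 ∨ 16 ≤ shaTwoPrimaryCard V := by
  by_cases h0 : shaTwoPrimaryCard V = 0
  · exact Or.inl h0
  · right
    haveI : Finite ↥(AddCommGroup.primaryComponent ↥V.sha 2) := Nat.finite_of_card_ne_zero h0
    have h16 : Nat.card ↥(V.sha ⊓ torsionBy V.galH1 (4 : ℕ)) = 16 := by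
      rw [natCard_inf_torsionBy_four_eq_sq V.sha hθ]
      unfold shaTwoCard at h2
      rw [h2]
    rw [← h16]
    exact natCard_inf_torsionBy_four_le_primaryComponent V.sha

/-! ## §3 DESC-28-E from DESC-28-B and DESC-28-C -/

/-- Arithmetic of the two factors: `{0} ∪ [16,∞)` times `{0} ∪ [4,∞)` lies in `{0} ∪ [64,∞)`. -/
private theorem mul_eq_zero_or_le {a b : ℕ} (ha : a = 0 ∨ 16 ≤ a) (hb : b = 0 ∨ 4 ≤ b) :
    a * b = 0 ∨ 64 ≤ a * b := by
  rcases ha with rfl | ha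
  · exact Or.inl (zero_mul b)
  rcases hb with rfl | hb
  · exact Or.inl (mul_zero a)
  exact Or.inr (le_trans (by norm_num) (Nat.mul_le_mul ha hb))

/-- **KERNEL glue: DESC-28-E `ResidueDoorFieldShaDeepAtTwo` is DESC-28-B + DESC-28-C** (no Cassels–Tate pairing, no finiteness):
at a rank-`0` door field of a residue curve whose two bits DISAGREE, `#Ш(W/K)[2] = 4` (row B) while `#Ш(W/K)[2^∞] =
#Ш(W)[2^∞]·#Ш(W^{(d_K)})[2^∞]` (row C) is infinite or `≥ 16·4 = 64 > 4²` (the `θ = +1` curve contributes `#Ш[4] = 16`), so some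
class of `Ш(W/K)` has order `8`. [cite: Kramer1981, Thm. 1, Prop. 7, Thm. 2] -/
theorem residueDoorFieldShaDeepAtTwo_of_rows :
    ResidueDoorFieldShaTwoCardAtTwo → ResidueDoorFieldShaOrderAtTwo → ResidueDoorFieldShaDeepAtTwo := by
  intro hB hC W _ _ h K _ _ hK hr hdis
  have h4K : fieldShaTwoCard W K = 4 := (hB W h K hK hr).2 hdis
  have hCK : fieldShaTwoPrimaryCard W K = shaTwoPrimaryCard W * shaTwoPrimaryCard (doorTwist W K) := hC W h K hK hr
  have hW : shaTwoCard W = 4 := h.2.2.2.1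
  have hWd : shaTwoCard (doorTwist W K) = 4 := shaTwoCard_doorTwist_eq_four W h K hK hr
  -- the product of the two `2`-primary orders is `0` or `≥ 64`
  have hprod : shaTwoPrimaryCard W * shaTwoPrimaryCard (doorTwist W K) = 0 ∨
      64 ≤ shaTwoPrimaryCard W * shaTwoPrimaryCard (doorTwist W K) := by
    unfold DoorBitsAgree at hdis
    by_cases hθ : ShaTwoInTwiceShaFour W
    · have hθd : ¬ ShaTwoInTwiceShaFour (doorTwist W K) := fun h' => hdis ⟨fun _ => h', fun _ => hθ⟩
      exact mul_eq_zero_or_le (shaTwoPrimaryCard_eq_zero_or_sixteen_le W hW hθ)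
        (shaTwoPrimaryCard_eq_zero_or_four_le _ hWd)
    · have hθd : ShaTwoInTwiceShaFour (doorTwist W K) := by
        by_contra h'
        exact hdis ⟨fun a => absurd a hθ, fun a => absurd a h'⟩
      rw [mul_comm]
      rcases mul_eq_zero_or_le (shaTwoPrimaryCard_eq_zero_or_sixteen_le _ hWd hθd)
        (shaTwoPrimaryCard_eq_zero_or_four_le W hW) with h0 | h64
      · exact Or.inl h0
      · exact Or.inr h64
  unfold fieldShaTwoCard at h4K
  unfold fieldShaTwoPrimaryCard at hCK
  refine exists_order_eight_of_natCard_primaryComponent (W.baseChange K).sha (n := 4) (by norm_num) h4K ?_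
  rw [hCK]
  rcases hprod with h0 | h64
  · exact Or.inl h0
  · exact Or.inr (by omega)

end Summit.BirchSwinnertonDyer.BirchSwinnertonDyer.Theorems.RankOneAtTwoOneDoor

end
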